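import Literature.Analysis.FluidPDE.InitialTimeCKNInduction
import Literature.Analysis.FluidPDE.InitialTimeCKNExtension
import Literature.Analysis.FluidPDE.InitialTimeCKNSmallness
import Literature.Analysis.FluidPDE.BarkerPrangeConcentrationOfThm1
import Literature.Analysis.FluidPDE.CKNEpsilonRegularityHolds
import HarnessLib

/-!
# Barker–Prange 2020, Theorem 2 (concentration of the `L³` norm near a Type-I singularity) — proved

Analysis/FluidPDE proof file **discharging the named fact
`Literature.Analysis.FluidPDE.BarkerPrange2020_thm2`** (`BarkerPrangeConcentration.lean`;
T. Barker, C. Prange, *Localized smoothing for the Navier–Stokes equations and concentration of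
critical norms near singularities*, Arch. Ration. Mech. Anal. 236 (2020) 1487–1541 =
arXiv:1812.09115, **Theorem 2**):

* `BarkerPrange2020_thm1_slab` — **Theorem 1 of the paper in the slab form used by its §4.2**
  (the hypothesis `hT1` of the accepted reduction `BarkerPrange2020_thm2_of_thm1`): there are a
  universal `γ > 0` and, for every `M > 0`, a time `S = S(M) ∈ (0, ¼]` such that every local
  energy solution `(v, π)` on `ℝ³ × (0, S)` (unit viscosity, Seregin's class) with datum
  `v₀ ∈ E²`, `‖v₀‖_{L²(B₁(x̄))} ≤ M` for all `x̄` and `‖v₀‖_{L³(B₂(0))} ≤ γ` is essentially bounded on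
  `(β, S) × B_{1/3}(0)` for every `β ∈ (0, S)`;
* `BarkerPrange2020_thm2_holds : BarkerPrange2020_thm2`.

## The proof of the slab form of Theorem 1 (module docstring of `InitialTimeCKNStep3.lean`)

Barker–Prange's own proof (§§2–4: a Caffarelli–Kohn–Nirenberg iteration and a bootstrap for the
Navier–Stokes equations perturbed by the critical drift given by the mild solution of the
localised datum) is replaced, for this qualitative slab statement, by a Caffarelli–Kohn–Nirenberg
induction **from the initial time in the scale-invariant normalisation**, run on the tree's fully
proved version of Robinson–Rodrigo–Sadowski's Thm. 15.3 machinery: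

1. *Gauge and zero extension* (`InitialTimeCKNExtension`): with the mean gauge
   `c(t) = ⨍_{B₁(0)} π(t)`, the triple `(U, P, G̃)` = extension by zero outside `(0, S)` of
   `(v, π - c, ∇v)` has on the unit cylinder `Q₁(S, 0)` every property of a suitable pair except
   that its local energy inequality carries the datum term `∫ |v₀|² φ(0, ·)` (Seregin's inequality
   from `t₀ = 0`).
2. *Unit-scale smallness* (`InitialTimeCKNSmallness`): for `S ≤ S(M)`,
   `∫₀^S∫_{B₁(0)} (|v|³ + |π - c|^{3/2}) ≤ ε₀` (a priori bound of Jia–Šverák 2013, Lemma 2, the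
   interpolation decay `≲ S^{1/4}` and the Kang–Miura–Tsai pressure estimate with its time
   dependence kept explicit); and `L³ ⊂ L^{2,Morrey}` is critical:
   `∫_{B_ρ(x̄)} |v₀|² ≤ 2 ‖v₀‖²_{L³(B₂)} ρ ≤ ε₀^{2/3} ρ` for `γ² = ε₀^{2/3}/2`.
3. *Induction* (`InitialTimeCKNInduction`): `C(r_n) + D_osc(r_n) ≤ ε₀^{2/3}` at every
   `z = (t, x̄)`, `0 < t < S`, `|x̄| < ½`, and every dyadic `r_n = 2⁻ⁿ`: smallness (not decay)
   propagates from the unit scale to all scales, the datum entering scale-invariantly.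
4. *ε-regularity at the scales `r_n² < β`*: there the cylinders `Q_{r_n}(z)` lie in the open slab,
   where `(v, π - c - ⨍_{B_{r_n}(x̄)}(π - c))` is a suitable weak solution with
   `∫∫_{Q_{r_n}} (|v|³ + |p|^{3/2}) ≤ 2 ε₀^{2/3} r_n² ≤ ε_L³ r_n²`; the proved ε-regularity theorem of
   Lemarié-Rieusset (Thm. 14.4, `lemarieRieusset_epsilon_regularity_holds`) bounds `|v|` by
   `C₀ ε_L / r_n` a.e. on `Q_{r_n/2}(z)`, uniformly in `z`.
5. *Covering*: `(β, S) × B_{1/3}(0)` is covered by the cylinders `Q_{r_n/2}(z)` with countably many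
   admissible apices `z` (rational times, a countable dense set of centres).

This is, in substance, an "ε-regularity criterion in terms of the initial data" in the sense of
Kang–Miura–Tsai (Pure Appl. Anal. 3 (2021) = arXiv:2006.13145, Thm. 1.1, Remark 1.2 (1)); the
constants are `γ` universal and `S = S(M)`, as printed in Theorem 1.

## References

* T. Barker, C. Prange, Arch. Ration. Mech. Anal. 236 (2020) 1487–1541 = arXiv:1812.09115:
  Thm. 1 (p. 2), Thm. 2 (pp. 4–5), §4 (pp. 15–16), Def. 16 (p. 17). [BarkerPrange2020]
* K. Kang, H. Miura, T.-P. Tsai, IMRN 2021 = arXiv:1812.10509, Thm. 1.1, Lemmas 3.4–3.5.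
  [KangMiuraTsai2020]
* K. Kang, H. Miura, T.-P. Tsai, Pure Appl. Anal. 3 (2021) = arXiv:2006.13145, Thm. 1.1,
  Remark 1.2 (the ε-regularity criterion in terms of initial data).
* J. C. Robinson, J. L. Rodrigo, W. Sadowski, *The three-dimensional Navier–Stokes equations*,
  CUP (2016), Thm. 15.3 and its proof. [RobinsonRodrigoSadowski2016]
* P. G. Lemarié-Rieusset, *The Navier–Stokes Problem in the 21st Century* (2016), Thm. 14.4.
  [LemarieRieusset2016]
* H. Jia, V. Šverák, SIAM J. Math. Anal. 45 (2013), Lemma 2. [JiaSverak2013]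
-/

noncomputable section

open MeasureTheory Set Function Filter Topology TopologicalSpace Metric
open scoped NNReal ENNReal InnerProductSpace RealInnerProductSpace Laplacian

namespace Literature.Analysis.FluidPDE

open RRS2016 BarkerPrange2020

/-! ### Helpers -/

/-- Backward parabolic cylinders of positive radius are connected (convex and nonempty). [folklore] -/
theorem BarkerPrange2020.isConnected_parabolicCylinder {r : ℝ} (hr : 0 < r)
    (z : ℝ × EuclideanSpace ℝ (Fin 3)) : IsConnected (parabolicCylinder r z) :=
  ⟨parabolicCylinder_nonempty hr z, ((convex_Ioo _ _).prod (convex_ball _ _)).isPreconnected⟩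

/-- **`L³` is critical for the datum term**: `∫_{B_ρ(x̄)} |v₀|² ≤ 2 (∫_{B₂(0)} |v₀|³)^{2/3} ρ` for
`|x̄| < 1/2`, `0 < ρ ≤ 1` (Hölder on the ball, `|B_ρ|^{1/3} = (4π/3)^{1/3} ρ ≤ 2ρ`,
`B_ρ(x̄) ⊆ B₂(0)`). [folklore] -/
theorem BarkerPrange2020.lintegral_ball_sq_le_of_cube {v₀ : EuclideanSpace ℝ (Fin 3) → EuclideanSpace ℝ (Fin 3)}
    (hm : AEStronglyMeasurable v₀ volume) {γ : ℝ} (hγ : 0 ≤ γ)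
    (h3 : eLpNorm v₀ 3 (volume.restrict (ball (0 : EuclideanSpace ℝ (Fin 3)) 2)) ≤ ENNReal.ofReal γ)
    {x : EuclideanSpace ℝ (Fin 3)} (hx : x ∈ ball (0 : EuclideanSpace ℝ (Fin 3)) (1 / 2))
    {ρ : ℝ} (hρ : 0 < ρ) (hρ1 : ρ ≤ 1) :
    ∫⁻ y in ball x ρ, ‖v₀ y‖ₑ ^ 2 ≤ ENNReal.ofReal (2 * γ ^ 2 * ρ) := by
  have hsub : ball x ρ ⊆ ball (0 : EuclideanSpace ℝ (Fin 3)) 2 := by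
    intro y hy
    rw [mem_ball] at hx hy ⊢
    calc dist y 0 ≤ dist y x + dist x 0 := dist_triangle _ _ _
      _ < ρ + 1 / 2 := add_lt_add hy hx
      _ ≤ 2 := by linarith
  have hF : AEMeasurable (fun y => ‖v₀ y‖ₑ) (volume.restrict (ball x ρ)) := hm.aemeasurable.enorm.restrict
  have H := setLIntegral_rpow_le_rpow_mul_measure volume (ball x ρ) hF (a := 2) (b := 3)
    (by norm_num) (by norm_num)
  have e2 : ∀ y, ‖v₀ y‖ₑ ^ (2 : ℝ) = ‖v₀ y‖ₑ ^ 2 := fun y => by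
    rw [show (2 : ℝ) = ((2 : ℕ) : ℝ) by norm_num, ENNReal.rpow_natCast]
  have e3 : ∀ y, ‖v₀ y‖ₑ ^ (3 : ℝ) = ‖v₀ y‖ₑ ^ (3 : ℕ) := fun y => by
    rw [show (3 : ℝ) = ((3 : ℕ) : ℝ) by norm_num, ENNReal.rpow_natCast]
  simp only [e2, e3] at H
  -- `(∫_{B_ρ(x)} |v₀|³)^{2/3} ≤ (∫_{B₂} |v₀|³)^{2/3} ≤ γ²`
  have h3' : (∫⁻ y in ball x ρ, ‖v₀ y‖ₑ ^ (3 : ℕ)) ^ ((2 : ℝ) / 3) ≤ ENNReal.ofReal (γ ^ 2) := by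
    have hL : ∫⁻ y in ball (0 : EuclideanSpace ℝ (Fin 3)) 2, ‖v₀ y‖ₑ ^ (3 : ℕ) =
        eLpNorm v₀ 3 (volume.restrict (ball (0 : EuclideanSpace ℝ (Fin 3)) 2)) ^ (3 : ℝ) := by
      rw [eLpNorm_eq_lintegral_rpow_enorm_toReal (by norm_num) (by norm_num), ENNReal.toReal_ofNat,
        ← ENNReal.rpow_mul, one_div, inv_mul_cancel₀ (by norm_num), ENNReal.rpow_one]
      exact lintegral_congr fun y => (e3 y).symm
    calc (∫⁻ y in ball x ρ, ‖v₀ y‖ₑ ^ (3 : ℕ)) ^ ((2 : ℝ) / 3)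
        ≤ (∫⁻ y in ball (0 : EuclideanSpace ℝ (Fin 3)) 2, ‖v₀ y‖ₑ ^ (3 : ℕ)) ^ ((2 : ℝ) / 3) :=
          ENNReal.rpow_le_rpow (lintegral_mono_set hsub) (by norm_num)
      _ = eLpNorm v₀ 3 (volume.restrict (ball (0 : EuclideanSpace ℝ (Fin 3)) 2)) ^ (2 : ℝ) := by
          rw [hL, ← ENNReal.rpow_mul]; norm_num
      _ ≤ ENNReal.ofReal γ ^ (2 : ℝ) := by gcongr
      _ = ENNReal.ofReal (γ ^ 2) := by
          rw [show (2 : ℝ) = ((2 : ℕ) : ℝ) by norm_num, ENNReal.rpow_natCast, ENNReal.ofReal_pow hγ]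
  -- `|B_ρ|^{1/3} ≤ 2ρ`
  have hvol : volume (ball x ρ) ^ (1 - (2 : ℝ) / 3) ≤ ENNReal.ofReal (2 * ρ) := by
    rw [EuclideanSpace.volume_ball_fin_three, ← ENNReal.ofReal_pow hρ.le,
      ← ENNReal.ofReal_mul (by positivity), show (1 : ℝ) - 2 / 3 = 1 / 3 by norm_num,
      ENNReal.ofReal_rpow_of_nonneg (by positivity) (by norm_num)]
    refine ENNReal.ofReal_le_ofReal ?_
    have hπ := Real.pi_lt_four
    have h8 : ρ ^ 3 * (Real.pi * 4 / 3) ≤ (2 * ρ) ^ 3 := by nlinarith [pow_pos hρ 3]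
    calc (ρ ^ 3 * (Real.pi * 4 / 3)) ^ (1 / 3 : ℝ) ≤ ((2 * ρ) ^ 3) ^ (1 / 3 : ℝ) :=
          Real.rpow_le_rpow (by positivity) h8 (by norm_num)
      _ = 2 * ρ := by
          rw [← Real.rpow_natCast _ 3, ← Real.rpow_mul (by positivity)]; norm_num
  calc ∫⁻ y in ball x ρ, ‖v₀ y‖ₑ ^ 2
      ≤ (∫⁻ y in ball x ρ, ‖v₀ y‖ₑ ^ (3 : ℕ)) ^ ((2 : ℝ) / 3) * volume (ball x ρ) ^ (1 - (2 : ℝ) / 3) := H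
    _ ≤ ENNReal.ofReal (γ ^ 2) * ENNReal.ofReal (2 * ρ) := mul_le_mul' h3' hvol
    _ = ENNReal.ofReal (2 * γ ^ 2 * ρ) := by rw [← ENNReal.ofReal_mul (sq_nonneg _)]; ring_nf

/-- **Gauging the pressure of a local energy solution by an `L^{3/2}(0, T)` function of time keeps
Seregin's class** — private copy of the accepted `IsLocalEnergySolutionOn.sub_timeGauge`
(`LocalEnergySliceE3.lean`), whose import closure (far-field regularity, limit bounds) is kept
out of this file's; the suitability clause is `IsSuitableWeakSolutionOn.sub_timeGauge_slab`, the
`L^{3/2}` class of `π - c` on the boxes `(0,T) × K` is `(a + b)^{3/2} ≤ √2 (a^{3/2} + b^{3/2})`.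
[cite: Seregin2014, Def. B.1 (B.1.4) with Remark B.4] -/
private theorem sub_timeGauge' {T ν : ℝ} {v₀ : EuclideanSpace ℝ (Fin 3) → EuclideanSpace ℝ (Fin 3)}
    {v : ℝ → EuclideanSpace ℝ (Fin 3) → EuclideanSpace ℝ (Fin 3)} {π : ℝ → EuclideanSpace ℝ (Fin 3) → ℝ}
    (h : IsLocalEnergySolutionOn T ν v₀ v π)
    {c : ℝ → ℝ} (hc : MemLp c (3 / 2 : ℝ≥0∞) (volume.restrict (Ioo 0 T))) :
    IsLocalEnergySolutionOn T ν v₀ v (fun t x => π t x - c t) := by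
  have hcT : ∫⁻ t in Ioo 0 T, ‖c t‖ₑ ^ (3 / 2 : ℝ) < ∞ := by
    have hm := hc.eLpNorm_lt_top
    rw [eLpNorm_lt_top_iff_lintegral_rpow_enorm_lt_top (by norm_num)
      (ENNReal.div_ne_top (by norm_num) (by norm_num))] at hm
    have e : ((3 / 2 : ℝ≥0∞)).toReal = (3 / 2 : ℝ) := by
      rw [ENNReal.toReal_div]; norm_num
    rw [e] at hm
    exact hm
  have hcm : AEStronglyMeasurable c (volume.restrict (Ioo 0 T)) := hc.aestronglyMeasurable
  refine
    { suitable := h.suitable.sub_timeGauge_slab hc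
      pressure := fun K hK => ?_
      sliceMeasurable := h.sliceMeasurable
      uniformLocalEnergy := h.uniformLocalEnergy
      uniformLocalGradient := h.uniformLocalGradient
      weakContinuous := h.weakContinuous
      initial := h.initial
      decay := h.decay }
  have hbox : (volume.restrict (Ioo (0 : ℝ) T)).prod (volume.restrict K) =
      volume.restrict (Ioo (0 : ℝ) T ×ˢ K) := by
    rw [Measure.prod_restrict, ← Measure.volume_eq_prod]
  have hcm2 : AEMeasurable (fun z : ℝ × EuclideanSpace ℝ (Fin 3) => ‖c z.1‖ₑ ^ (3 / 2 : ℝ))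
      (volume.restrict (Ioo (0 : ℝ) T ×ˢ K)) := by
    rw [← hbox]
    exact (hcm.comp_fst.enorm.pow_const _)
  have hcbox : ∫⁻ z in Ioo (0 : ℝ) T ×ˢ K, ‖c z.1‖ₑ ^ (3 / 2 : ℝ) < ∞ := by
    rw [← hbox, lintegral_prod _ (by rw [hbox]; exact hcm2)]
    simp only [lintegral_const, Measure.restrict_apply_univ]
    rw [lintegral_mul_const'' _ (hcm.enorm.pow_const _)]
    exact ENNReal.mul_lt_top hcT hK.measure_lt_top
  calc ∫⁻ z in Ioo 0 T ×ˢ K, ‖(fun t x => π t x - c t) z.1 z.2‖ₑ ^ (3 / 2 : ℝ)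
      ≤ ∫⁻ z in Ioo 0 T ×ˢ K, (2 : ℝ≥0∞) ^ ((3 / 2 : ℝ) - 1) *
          (‖π z.1 z.2‖ₑ ^ (3 / 2 : ℝ) + ‖c z.1‖ₑ ^ (3 / 2 : ℝ)) := by
        refine lintegral_mono fun z => ?_
        calc ‖π z.1 z.2 - c z.1‖ₑ ^ (3 / 2 : ℝ) ≤ (‖π z.1 z.2‖ₑ + ‖c z.1‖ₑ) ^ (3 / 2 : ℝ) := by
              gcongr; exact enorm_sub_le
          _ ≤ _ := ENNReal.rpow_add_le_mul_rpow_add_rpow _ _ (by norm_num)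
    _ = (2 : ℝ≥0∞) ^ ((3 / 2 : ℝ) - 1) * ((∫⁻ z in Ioo 0 T ×ˢ K, ‖π z.1 z.2‖ₑ ^ (3 / 2 : ℝ)) +
          ∫⁻ z in Ioo 0 T ×ˢ K, ‖c z.1‖ₑ ^ (3 / 2 : ℝ)) := by
        rw [lintegral_const_mul' _ _ (ENNReal.rpow_ne_top_of_nonneg (by norm_num) ENNReal.ofNat_ne_top),
          lintegral_add_right' _ hcm2]
    _ < ∞ := by
        refine ENNReal.mul_lt_top (ENNReal.rpow_lt_top_of_nonneg (by norm_num) ENNReal.ofNat_ne_top) ?_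
        exact ENNReal.add_lt_top.2 ⟨h.pressure K hK, hcbox⟩

/-- From `‖v₀‖_{L²(B₁(x̄))} ≤ M`: `∫_{B₁(x̄)} |v₀|² ≤ M²`. [folklore] -/
theorem BarkerPrange2020.lintegral_unitBall_sq_le_of_eLpNorm {v₀ : EuclideanSpace ℝ (Fin 3) → EuclideanSpace ℝ (Fin 3)}
    {M : ℝ} (hM : 0 ≤ M) {x : EuclideanSpace ℝ (Fin 3)}
    (h : eLpNorm v₀ 2 (volume.restrict (ball x 1)) ≤ ENNReal.ofReal M) :
    ∫⁻ y in ball x 1, ‖v₀ y‖ₑ ^ 2 ≤ ENNReal.ofReal (M ^ 2) := by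
  have hL : ∫⁻ y in ball x 1, ‖v₀ y‖ₑ ^ 2 = eLpNorm v₀ 2 (volume.restrict (ball x 1)) ^ (2 : ℝ) := by
    rw [eLpNorm_eq_lintegral_rpow_enorm_toReal two_ne_zero ENNReal.ofNat_ne_top, ENNReal.toReal_ofNat,
      ← ENNReal.rpow_mul, one_div, inv_mul_cancel₀ (by norm_num), ENNReal.rpow_one]
    refine lintegral_congr fun y => ?_
    rw [show (2 : ℝ) = ((2 : ℕ) : ℝ) by norm_num, ENNReal.rpow_natCast]
  rw [hL]
  calc eLpNorm v₀ 2 (volume.restrict (ball x 1)) ^ (2 : ℝ) ≤ ENNReal.ofReal M ^ (2 : ℝ) := by gcongr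
    _ = ENNReal.ofReal (M ^ 2) := by
        rw [show (2 : ℝ) = ((2 : ℕ) : ℝ) by norm_num, ENNReal.rpow_natCast, ENNReal.ofReal_pow hM]

/-! ### Theorem 1 of Barker–Prange in slab form -/

set_option maxHeartbeats 3200000 in
/-- **Barker–Prange 2020, Theorem 1, in the slab form used by the proof of Theorem 2 (§4.2)**:
there are a universal `γ > 0` and, for every `M > 0`, a time `S = S(M) ∈ (0, ¼]` such that every
local energy solution `(v, π)` on `ℝ³ × (0, S)` with unit viscosity (`IsLocalEnergySolutionOn S 1 v₀ v π`,
Seregin 2014 Def. B.1 = the paper's Def. 16 on the finite strip) whose datum lies in `E²` with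
`‖v₀‖_{L²(B₁(x̄))} ≤ M` for all `x̄` and `‖v₀‖_{L³(B₂(0))} ≤ γ` is essentially bounded on
`(β, S) × B_{1/3}(0)` for every `β ∈ (0, S)` — verbatim the hypothesis `hT1` of
`BarkerPrange2020_thm2_of_thm1`. Proved by the initial-time Caffarelli–Kohn–Nirenberg induction
(module docstring): gauge and zero extension (`InitialTimeCKNExtension`), unit-scale smallness for
`S ≤ S(M)` (`InitialTimeCKNSmallness`), the induction `C(r_n) + D_osc(r_n) ≤ ε₀^{2/3}` at all dyadic
scales (`BarkerPrange2020.initialInduction`), the proved ε-regularity theorem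
`lemarieRieusset_epsilon_regularity_holds` on the interior cylinders of scale `r_n² < β`, and a
countable covering. [cite: BarkerPrange2020, Thm. 1 (arXiv:1812.09115 p. 2) with §4.1; KangMiuraTsai2020 Thm. 1.1] -/
theorem BarkerPrange2020_thm1_slab :
    ∃ γ : ℝ, 0 < γ ∧ ∀ M : ℝ, 0 < M → ∃ S : ℝ, 0 < S ∧ S ≤ 1 / 4 ∧
      ∀ (v₀ : EuclideanSpace ℝ (Fin 3) → EuclideanSpace ℝ (Fin 3))
        (v : ℝ → EuclideanSpace ℝ (Fin 3) → EuclideanSpace ℝ (Fin 3))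
        (π : ℝ → EuclideanSpace ℝ (Fin 3) → ℝ),
        IsLocalEnergySolutionOn S 1 v₀ v π → MemE2 v₀ →
        (∀ x₁ : EuclideanSpace ℝ (Fin 3),
          eLpNorm v₀ 2 (volume.restrict (ball x₁ 1)) ≤ ENNReal.ofReal M) →
        eLpNorm v₀ 3 (volume.restrict (ball (0 : EuclideanSpace ℝ (Fin 3)) 2)) ≤ ENNReal.ofReal γ →
        ∀ β ∈ Ioo 0 S, eLpNorm (uncurry v) ∞
          (volume.restrict (Ioo β S ×ˢ ball (0 : EuclideanSpace ℝ (Fin 3)) (1 / 3))) < ∞ := by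
  -- ## universal constants
  obtain ⟨εs, hεs, Hind⟩ := initialInduction
  obtain ⟨εL, C₀, hεL, hC₀, HLR⟩ := lemarieRieusset_epsilon_regularity_holds 1 3 one_pos (by norm_num)
  set ε₀ : ℝ := min εs ((εL ^ 3 / 2) ^ (3 / 2 : ℝ)) with hε₀
  have hε₀pos : 0 < ε₀ := lt_min hεs (Real.rpow_pos_of_pos (by positivity) _)
  have hε₀εs : ε₀ ≤ εs := min_le_left _ _
  set m : ℝ := ε₀ ^ (2 / 3 : ℝ) with hm
  have hm0 : 0 < m := Real.rpow_pos_of_pos hε₀pos _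
  have hmL : 2 * m ≤ εL ^ 3 := by
    have h1 : ε₀ ≤ (εL ^ 3 / 2) ^ (3 / 2 : ℝ) := min_le_right _ _
    have h2 : ε₀ ^ (2 / 3 : ℝ) ≤ ((εL ^ 3 / 2) ^ (3 / 2 : ℝ)) ^ (2 / 3 : ℝ) :=
      Real.rpow_le_rpow hε₀pos.le h1 (by norm_num)
    rw [← Real.rpow_mul (by positivity)] at h2
    norm_num at h2
    rw [hm]
    linarith
  set γ : ℝ := Real.sqrt (m / 2) with hγ
  have hγpos : 0 < γ := Real.sqrt_pos.2 (by positivity)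
  have hγsq : 2 * γ ^ 2 = m := by rw [hγ, Real.sq_sqrt (by positivity)]; ring
  refine ⟨γ, hγpos, fun M hM => ?_⟩
  -- ## the time `S = S(M)`
  set α : ℝ≥0 := Real.toNNReal (M ^ 2 / 2) with hα
  obtain ⟨S₀, hS₀, -, Hsmall⟩ := exists_unitScale_small α hε₀pos
  set S : ℝ := min S₀ (1 / 4) with hSdef
  have hS : 0 < S := lt_min hS₀ (by norm_num)
  have hS4 : S ≤ 1 / 4 := min_le_right _ _
  have hSS₀ : S ≤ S₀ := min_le_left _ _
  refine ⟨S, hS, hS4, fun v₀ v π h hE2 hMb hγb β hβ => ?_⟩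
  -- ## the datum
  have hm₀ : AEStronglyMeasurable v₀ volume := hE2.aestronglyMeasurable
  have hdat : ∀ x₀ : EuclideanSpace ℝ (Fin 3), ∫⁻ x in ball x₀ 1, ‖v₀ x‖ₑ ^ 2 ≤ 2 * (α : ℝ≥0∞) := by
    intro x₀
    refine (lintegral_unitBall_sq_le_of_eLpNorm hM.le (hMb x₀)).trans (le_of_eq ?_)
    rw [show M ^ 2 = 2 * (M ^ 2 / 2) by ring, ENNReal.ofReal_mul zero_le_two, ENNReal.ofReal_ofNat]
    rfl
  -- ## unit-scale smallness and the weak gradient of the class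
  obtain ⟨G, hG, hGR, hsmallS⟩ := Hsmall S hS hSS₀ v₀ v π hm₀ h hdat
  -- ## the gauge and the gauged solution
  set c : ℝ → ℝ := fun t => ⨍ y in ball (0 : EuclideanSpace ℝ (Fin 3)) 1, π t y with hc
  have hcL : MemLp c (3 / 2 : ℝ≥0∞) (volume.restrict (Ioo 0 S)) :=
    h.isLocalLeraySolutionOn.memLp_setAverage_pressure 0 one_pos
  set π' : ℝ → EuclideanSpace ℝ (Fin 3) → ℝ := fun t x => π t x - c t with hπ'
  have h' : IsLocalEnergySolutionOn S 1 v₀ v π' := sub_timeGauge' h hcL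
  -- ## the zero extensions
  set U : ℝ → EuclideanSpace ℝ (Fin 3) → EuclideanSpace ℝ (Fin 3) :=
    fun t x => if t ∈ Ioo 0 S then v t x else 0 with hU
  set P : ℝ → EuclideanSpace ℝ (Fin 3) → ℝ := fun t x => if t ∈ Ioo 0 S then π' t x else 0 with hP
  set Gt : ℝ → EuclideanSpace ℝ (Fin 3) → EuclideanSpace ℝ (Fin 3) →L[ℝ] EuclideanSpace ℝ (Fin 3) :=
    fun t x => if t ∈ Ioo 0 S then G t x else 0 with hGt
  have hUin : ∀ t ∈ Ioo 0 S, U t = v t := fun t ht => funext fun x => if_pos ht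
  have hUout : ∀ t, t ∉ Ioo 0 S → U t = 0 := fun t ht => funext fun x => if_neg ht
  have hPin : ∀ t ∈ Ioo 0 S, P t = π' t := fun t ht => funext fun x => if_pos ht
  have hPout : ∀ t, t ∉ Ioo 0 S → P t = 0 := fun t ht => funext fun x => if_neg ht
  have hGin : ∀ t ∈ Ioo 0 S, Gt t = G t := fun t ht => funext fun x => if_pos ht
  have hGout : ∀ t, t ∉ Ioo 0 S → Gt t = 0 := fun t ht => funext fun x => if_neg ht
  -- ## the unit cylinder at the apex `z₀ = (S, 0)`
  set z₀ : ℝ × EuclideanSpace ℝ (Fin 3) := (S, 0) with hz₀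
  have hQ1sub : parabolicCylinder 1 z₀ ⊆ {w | w.1 < S} := fun w hw => (mem_parabolicCylinder.1 hw).1.2
  have hGw : HasWeakSpatialGradientOn (parabolicCylinderOpens 1 z₀) U Gt :=
    (hasWeakSpatialGradientOn_extension h hS hG hGR hUin hUout hGin hGout).mono le_top
  have hG2 := lintegral_cylinder_frobeniusNormSq_extension_lt_top (T := S) hGR hGin hGout z₀
  have hp_li := locallyIntegrableOn_pressure_extension h' hPin hPout (parabolicCylinder 1 z₀)
  have hp32 := lintegral_cylinder_pressure_extension_lt_top h' hPin hPout z₀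
  have hdivQ : ∀ θ : ℝ → EuclideanSpace ℝ (Fin 3) → ℝ, IsSpaceTimeTestOn (parabolicCylinderOpens 1 z₀) θ →
      ∫ w in parabolicCylinder 1 z₀, ⟪U w.1 w.2, gradient (θ w.1) w.2⟫ = 0 := by
    intro θ hθ
    have key := integral_inner_gradient_extension_eq_zero h hS hUin hUout (hθ.mono le_top)
    rw [← key]
    refine setIntegral_eq_integral_of_forall_compl_eq_zero fun w hw => ?_
    obtain ⟨-, -, hg0⟩ := hθ.continuous_gradient_field
    rw [hg0 w (fun h'' => hw (hθ.tsupport_subset h'')), inner_zero_right]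
  have hPeqQ : ∀ φ : ℝ → EuclideanSpace ℝ (Fin 3) → ℝ, IsSpaceTimeTestOn (parabolicCylinderOpens 1 z₀) φ →
      ∫ w in parabolicCylinder 1 z₀,
        (⟪U w.1 w.2, convect (U w.1) (gradient (φ w.1)) w.2⟫ + P w.1 w.2 * Δ (φ w.1) w.2) = 0 := by
    intro φ hφ
    have key := pressureEq_extension h' hS hUin hUout hPin hPout (hφ.mono le_top)
    rw [← key]
    refine setIntegral_eq_integral_of_forall_compl_eq_zero fun w hw => ?_
    have hw' : (w.1, w.2) ∉ ((parabolicCylinderOpens 1 z₀ : Opens (ℝ × EuclideanSpace ℝ (Fin 3))) :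
        Set (ℝ × EuclideanSpace ℝ (Fin 3))) := hw
    rw [hφ.convect_gradient_eq_zero hw' _, hφ.laplacian_slice_eq_zero hw', inner_zero_right, mul_zero,
      add_zero]
  have hLEIQ : ∀ φ : ℝ → EuclideanSpace ℝ (Fin 3) → ℝ, IsSpaceTimeTestOn (parabolicCylinderOpens 1 z₀) φ →
      (∀ t x, 0 ≤ φ t x) →
      2 * 1 * ∫ t, ∫ x, frobeniusNormSq (Gt t x) * φ t x ≤
        (∫ x, ‖v₀ x‖ ^ 2 * φ 0 x) +
          ∫ t, ∫ x, (‖U t x‖ ^ 2 * (timeDeriv φ t x + 1 * Δ (φ t) x) +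
            (‖U t x‖ ^ 2 + 2 * P t x) * ⟪U t x, gradient (φ t) x⟫) := by
    intro φ hφ hφ0
    have hφ' : IsSpaceTimeTestOn (slab (EuclideanSpace ℝ (Fin 3)) (Iio S) isOpen_Iio) φ :=
      hφ.of_tsupport_subset fun w hw => mem_slab.2 (hQ1sub (hφ.tsupport_subset hw))
    exact localEnergyIneq_datum_extension h' hS hm₀ hG hGR hUin hUout hPin hPout hGin hGout hφ' hφ0
  -- ## the one-scale smallness of the extension
  set Sl : Set (ℝ × EuclideanSpace ℝ (Fin 3)) := Ioo 0 S ×ˢ (univ : Set (EuclideanSpace ℝ (Fin 3))) with hSl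
  have hSlm : MeasurableSet Sl := measurableSet_Ioo.prod MeasurableSet.univ
  have hsmall : RRS2016.Small ε₀ U P z₀ := by
    unfold RRS2016.Small
    have e : (fun w : ℝ × EuclideanSpace ℝ (Fin 3) => ‖U w.1 w.2‖ₑ ^ (3 : ℕ) + ‖P w.1 w.2‖ₑ ^ (3 / 2 : ℝ)) =
        Sl.indicator fun w => ‖v w.1 w.2‖ₑ ^ (3 : ℕ) +
          ‖π w.1 w.2 - ⨍ y in ball (0 : EuclideanSpace ℝ (Fin 3)) 1, π w.1 y‖ₑ ^ (3 / 2 : ℝ) := by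
      funext w
      by_cases hw : w ∈ Sl
      · rw [indicator_of_mem hw]
        simp only [hU, hP, hπ', hc, if_pos hw.1]
      · rw [indicator_of_notMem hw]
        have : w.1 ∉ Ioo 0 S := fun h'' => hw ⟨h'', mem_univ _⟩
        simp only [hU, hP, if_neg this, enorm_zero, ENNReal.zero_rpow_of_pos (by norm_num : (0 : ℝ) < 3 / 2),
          add_zero, pow_succ, mul_zero]
    rw [e, lintegral_indicator hSlm, Measure.restrict_restrict hSlm]
    have hsub : Sl ∩ parabolicCylinder 1 z₀ ⊆ Ioo 0 S ×ˢ ball (0 : EuclideanSpace ℝ (Fin 3)) 1 := fun w hw =>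
      ⟨hw.1.1, (mem_parabolicCylinder.1 hw.2).2⟩
    exact (lintegral_mono_set hsub).trans (hsmallS 0)
  -- ## the induction: smallness at all dyadic scales
  have hA : ∀ z ∈ parabolicCylinder (1 / 2) z₀, z.2 ∈ ball (0 : EuclideanSpace ℝ (Fin 3)) (1 / 2) →
      ∀ n : ℕ, 1 ≤ n → cknC (rad n) z U + cknDOsc (rad n) z P ≤ ENNReal.ofReal (ε₀ ^ (2 / 3 : ℝ)) := by
    intro z hz hz2 n hn
    refine Hind z₀ v₀ U P Gt hGw hG2 hp_li hp32 hdivQ hPeqQ hLEIQ ε₀ hε₀pos hε₀εs hsmall z hz ?_ n hn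
    intro ρ hρ hρ1
    refine (lintegral_ball_sq_le_of_cube hm₀ hγpos.le hγb hz2 hρ hρ1).trans (le_of_eq ?_)
    rw [show 2 * γ ^ 2 * ρ = (2 * γ ^ 2) * ρ by ring, hγsq]
  -- ## the scale `r = r_n` with `r ≤ 1/4`, `r² < β`
  obtain ⟨n, hnlt⟩ := exists_pow_lt_of_lt_one (show 0 < min (Real.sqrt β / 2) (1 / 4) by
    have := hβ.1; positivity) (by norm_num : (1 / 2 : ℝ) < 1)
  set r : ℝ := rad n with hrdef
  have hr : 0 < r := rad_pos n
  have hreq : r = (1 / 2 : ℝ) ^ n := rfl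
  have hr4 : r ≤ 1 / 4 := by rw [hreq]; exact (hnlt.le).trans (min_le_right _ _)
  have hrβ : r ^ 2 < β := by
    have h1 : r < Real.sqrt β / 2 := by rw [hreq]; exact lt_of_lt_of_le hnlt (min_le_left _ _)
    have h2 : r < Real.sqrt β := by linarith [Real.sqrt_nonneg β]
    calc r ^ 2 < Real.sqrt β ^ 2 := by gcongr
      _ = β := Real.sq_sqrt hβ.1.le
  have hn1 : 1 ≤ n := by
    by_contra h0
    push Not at h0
    interval_cases n
    simp [hreq] at hr4
    linarith
  -- ## the pointwise bound on the interior cylinders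
  set B : ℝ := C₀ * εL / r with hB
  have hapex : ∀ t ∈ Ioo β S, ∀ xb ∈ ball (0 : EuclideanSpace ℝ (Fin 3)) (1 / 2),
      ∀ᵐ w ∂(volume.restrict (parabolicCylinder (r / 2) (t, xb))), ‖v w.1 w.2‖ ≤ B := by
    intro t ht xb hxb
    set z : ℝ × EuclideanSpace ℝ (Fin 3) := (t, xb) with hzdef
    have hz : z ∈ parabolicCylinder (1 / 2) z₀ := by
      rw [mem_parabolicCylinder]
      refine ⟨⟨?_, ht.2⟩, by simpa [hz₀] using hxb⟩
      show S - (1 / 2) ^ 2 < t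
      linarith [ht.1, hβ.1]
    have hAz := hA z hz (by simpa using hxb) n hn1
    -- `Q_r(z)` lies in the open slab
    set Qr := parabolicCylinder r z with hQr
    have htr : 0 < t - r ^ 2 := by linarith [ht.1]
    have hQr_slab : Qr ⊆ Sl := fun w hw =>
      ⟨⟨lt_trans htr (mem_parabolicCylinder.1 hw).1.1, lt_trans (mem_parabolicCylinder.1 hw).1.2 ht.2⟩, mem_univ _⟩
    have hQrO : (parabolicCylinderOpens r z : Opens (ℝ × EuclideanSpace ℝ (Fin 3))) ≤
        slab (EuclideanSpace ℝ (Fin 3)) (Ioo 0 S) isOpen_Ioo := hQr_slab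
    -- the doubly gauged pressure on the slab
    set m₂ : ℝ → ℝ := fun s => ⨍ y in ball xb r, π' s y with hm₂
    have hm₂L : MemLp m₂ (3 / 2 : ℝ≥0∞) (volume.restrict (Ioo 0 S)) :=
      h'.isLocalLeraySolutionOn.memLp_setAverage_pressure xb hr
    set p'' : ℝ → EuclideanSpace ℝ (Fin 3) → ℝ := fun s y => π' s y - m₂ s with hp''
    have hsw : IsSuitableWeakSolutionOn (slab (EuclideanSpace ℝ (Fin 3)) (Ioo 0 S) isOpen_Ioo) 1 0 v p'' :=
      h'.suitable.sub_timeGauge_slab hm₂L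
    obtain ⟨G'', hG'', hG''2, hLEI''⟩ := hsw.localEnergy
    -- smallness on `Q_r(z)`
    have hmeas3 : AEMeasurable (fun w : ℝ × EuclideanSpace ℝ (Fin 3) => ‖v w.1 w.2‖ₑ ^ (3 : ℕ))
        (volume.restrict Qr) :=
      ((h.aestronglyMeasurable.mono_measure (Measure.restrict_mono hQr_slab le_rfl)).enorm.pow_const _)
    have hsm : ∫⁻ w in Qr, (‖v w.1 w.2‖ₑ ^ (3 : ℕ) + ‖p'' w.1 w.2‖ₑ ^ (3 / 2 : ℝ)) ≤
        ENNReal.ofReal (εL ^ 3 * r ^ 2) := by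
      have hQm : MeasurableSet Qr := (isOpen_parabolicCylinder r z).measurableSet
      have e1 : ∫⁻ w in Qr, ‖v w.1 w.2‖ₑ ^ (3 : ℕ) = ENNReal.ofReal r ^ 2 * cknC r z U := by
        rw [← lintegral_cube_eq_mul_cknC hr z U]
        refine setLIntegral_congr_fun hQm fun w hw => ?_
        rw [hUin w.1 (hQr_slab hw).1]
      have e2 : ∫⁻ w in Qr, ‖p'' w.1 w.2‖ₑ ^ (3 / 2 : ℝ) = ENNReal.ofReal r ^ 2 * cknDOsc r z P := by
        have h0 : ENNReal.ofReal r ^ 2 ≠ 0 := pow_ne_zero _ (ENNReal.ofReal_pos.2 hr).ne'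
        have htop : ENNReal.ofReal r ^ 2 ≠ ∞ := ENNReal.pow_ne_top ENNReal.ofReal_ne_top
        rw [cknDOsc, ← mul_assoc, ENNReal.mul_inv_cancel h0 htop, one_mul]
        refine setLIntegral_congr_fun hQm fun w hw => ?_
        have hPw : P w.1 = π' w.1 := hPin w.1 (hQr_slab hw).1
        simp only [hp'', hm₂, hPw]
        rfl
      rw [lintegral_add_left' hmeas3, e1, e2, ← mul_add]
      calc ENNReal.ofReal r ^ 2 * (cknC r z U + cknDOsc r z P)
          ≤ ENNReal.ofReal r ^ 2 * ENNReal.ofReal (ε₀ ^ (2 / 3 : ℝ)) := by gcongr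
        _ = ENNReal.ofReal (r ^ 2 * ε₀ ^ (2 / 3 : ℝ)) := by
            rw [← ENNReal.ofReal_pow hr.le, ← ENNReal.ofReal_mul (by positivity)]
        _ ≤ ENNReal.ofReal (εL ^ 3 * r ^ 2) := by
            refine ENNReal.ofReal_le_ofReal ?_
            rw [← hm]
            nlinarith [hm0, pow_pos hr 2]
    -- the hypotheses of Thm. 14.4 on `Q_r(z)`
    have hconn := BarkerPrange2020.isConnected_parabolicCylinder hr z
    have henergy : ∃ C : ℝ≥0, ∀ᵐ s : ℝ,
        ∫⁻ y, ((parabolicCylinderOpens r z : Opens (ℝ × EuclideanSpace ℝ (Fin 3))) :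
          Set (ℝ × EuclideanSpace ℝ (Fin 3))).indicator
            (fun w : ℝ × EuclideanSpace ℝ (Fin 3) => ‖v w.1 w.2‖ₑ ^ 2) (s, y) ≤ C := by
      obtain ⟨CE, hCE⟩ := h.uniformLocalEnergy
      refine ⟨CE, ae_of_all _ fun s => ?_⟩
      by_cases hs : s ∈ Ioo (t - r ^ 2) t
      · have e : (fun y => ((parabolicCylinderOpens r z : Opens (ℝ × EuclideanSpace ℝ (Fin 3))) :
            Set (ℝ × EuclideanSpace ℝ (Fin 3))).indicator
              (fun w : ℝ × EuclideanSpace ℝ (Fin 3) => ‖v w.1 w.2‖ₑ ^ 2) (s, y)) =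
            (ball xb r).indicator fun y => ‖v s y‖ₑ ^ 2 := by
          funext y
          by_cases hy : y ∈ ball xb r
          · rw [indicator_of_mem hy, indicator_of_mem]
            exact mem_parabolicCylinder.2 ⟨hs, mem_ball.1 hy⟩
          · rw [indicator_of_notMem hy, indicator_of_notMem]
            exact fun h'' => hy (mem_ball.2 (mem_parabolicCylinder.1 h'').2)
        rw [e, lintegral_indicator measurableSet_ball]
        have hsI : s ∈ Icc 0 S := ⟨(lt_trans htr hs.1).le, (lt_trans hs.2 ht.2).le⟩
        exact (lintegral_mono_set (ball_subset_ball (by linarith))).trans (hCE s hsI xb)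
      · have e : (fun y => ((parabolicCylinderOpens r z : Opens (ℝ × EuclideanSpace ℝ (Fin 3))) :
            Set (ℝ × EuclideanSpace ℝ (Fin 3))).indicator
              (fun w : ℝ × EuclideanSpace ℝ (Fin 3) => ‖v w.1 w.2‖ₑ ^ 2) (s, y)) = fun _ => 0 := by
          funext y
          rw [indicator_of_notMem]
          exact fun h'' => hs (mem_parabolicCylinder.1 h'').1
        rw [e, lintegral_zero]
        exact zero_le
    have hGQ : HasWeakSpatialGradientOn (parabolicCylinderOpens r z) v G'' := hG''.mono hQrO
    have hKcl : closure Qr ⊆ Sl := (closure_parabolicCylinder_subset r z).trans fun w hw =>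
      ⟨⟨lt_of_lt_of_le htr hw.1.1, lt_of_le_of_lt hw.1.2 ht.2⟩, mem_univ _⟩
    have hKc : IsCompact (closure Qr) :=
      (isCompact_Icc.prod (isCompact_closedBall _ _)).of_isClosed_subset isClosed_closure
        (closure_parabolicCylinder_subset r z)
    have hG''Q : ∫⁻ w in Qr, ENNReal.ofReal (frobeniusNormSq (G'' w.1 w.2)) < ∞ :=
      (lintegral_mono_set subset_closure).trans_lt (hG''2 _ hKcl hKc)
    have hp''Q : ∫⁻ w in Qr, ‖p'' w.1 w.2‖ₑ ^ (3 / 2 : ℝ) < ∞ :=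
      lt_of_le_of_lt ((lintegral_mono fun w => le_add_self).trans hsm) ENNReal.ofReal_lt_top
    have hf : MemLp (uncurry (0 : ℝ → EuclideanSpace ℝ (Fin 3) → EuclideanSpace ℝ (Fin 3))) (ENNReal.ofReal 3)
        (volume.restrict Qr) := MemLp.zero'
    have hns : IsDistributionalNSSolutionOn (parabolicCylinderOpens r z) 1 0 v p'' :=
      hsw.distributional.of_le hQrO
    have hLEIr : ∀ φ : ℝ → EuclideanSpace ℝ (Fin 3) → ℝ, IsSpaceTimeTestOn (parabolicCylinderOpens r z) φ →
        (∀ t x, 0 ≤ φ t x) →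
        2 * 1 * ∫ t, ∫ x, frobeniusNormSq (G'' t x) * φ t x ≤
          ∫ t, ∫ x, (‖v t x‖ ^ 2 * (timeDeriv φ t x + 1 * Δ (φ t) x) +
            (‖v t x‖ ^ 2 + 2 * p'' t x) * ⟪v t x, gradient (φ t) x⟫ +
            2 * ⟪(0 : ℝ → EuclideanSpace ℝ (Fin 3) → EuclideanSpace ℝ (Fin 3)) t x, v t x⟫ * φ t x) :=
      fun φ hφ hφ0 => hLEI'' φ (hφ.mono hQrO) hφ0
    have hforce : ∫⁻ w in parabolicCylinder r z,
        ‖(0 : ℝ → EuclideanSpace ℝ (Fin 3) → EuclideanSpace ℝ (Fin 3)) w.1 w.2‖ₑ ^ (3 : ℝ) ≤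
          ENNReal.ofReal (εL ^ ((2 : ℝ) * 3) * r ^ ((5 : ℝ) - 3 * 3)) := by
      simp only [Pi.zero_apply, enorm_zero, ENNReal.zero_rpow_of_pos (by norm_num : (0 : ℝ) < 3), lintegral_zero]
      exact zero_le
    have key := HLR (parabolicCylinderOpens r z) 0 v p'' G'' hconn henergy hGQ hG''Q hp''Q hf hns hLEIr z r εL hr
      Subset.rfl hεL.le le_rfl hsm hforce
    simpa [hB] using key
  -- ## the countable covering and the conclusion
  obtain ⟨D, hDc, hDd⟩ := TopologicalSpace.exists_countable_dense (EuclideanSpace ℝ (Fin 3))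
  set A : Set (ℝ × EuclideanSpace ℝ (Fin 3)) :=
    (range (fun q : ℚ => (q : ℝ)) ∩ Ioo β S) ×ˢ (D ∩ ball (0 : EuclideanSpace ℝ (Fin 3)) (1 / 2)) with hAdef
  have hAc : A.Countable :=
    ((countable_range _).mono inter_subset_left).prod (hDc.mono inter_subset_left)
  have hcover : Ioo β S ×ˢ ball (0 : EuclideanSpace ℝ (Fin 3)) (1 / 3) ⊆ ⋃ z ∈ A, parabolicCylinder (r / 2) z := by
    rintro ⟨s, x⟩ ⟨hs, hx⟩
    obtain ⟨xb, hxbD, hxb⟩ := hDd.exists_dist_lt x (show 0 < r / 2 by positivity)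
    have hlt : s < min S (s + (r / 2) ^ 2) := lt_min hs.2 (by nlinarith [hr])
    obtain ⟨q, hq1, hq2⟩ := exists_rat_btwn hlt
    have hqS : (q : ℝ) < S := lt_of_lt_of_le hq2 (min_le_left _ _)
    have hqs : (q : ℝ) < s + (r / 2) ^ 2 := lt_of_lt_of_le hq2 (min_le_right _ _)
    have hxb2 : xb ∈ ball (0 : EuclideanSpace ℝ (Fin 3)) (1 / 2) := by
      rw [mem_ball] at hx ⊢
      calc dist xb 0 ≤ dist xb x + dist x 0 := dist_triangle _ _ _
        _ < r / 2 + 1 / 3 := by rw [dist_comm]; exact add_lt_add hxb hx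
        _ ≤ 1 / 2 := by linarith
    refine mem_iUnion₂.2 ⟨((q : ℝ), xb), ⟨⟨⟨q, rfl⟩, ⟨lt_trans hs.1 hq1, hqS⟩⟩, hxbD, hxb2⟩, ?_⟩
    rw [mem_parabolicCylinder]
    exact ⟨⟨by simp only; linarith, hq1⟩, by simpa [dist_comm] using hxb⟩
  have hae : ∀ᵐ w ∂(volume.restrict (⋃ z ∈ A, parabolicCylinder (r / 2) z)),
      ‖uncurry v w‖ ≤ B := by
    rw [ae_restrict_biUnion_iff _ hAc]
    rintro ⟨tq, xb⟩ ⟨⟨-, htq⟩, -, hxb⟩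
    exact hapex tq htq xb hxb
  have hae' : ∀ᵐ w ∂(volume.restrict (Ioo β S ×ˢ ball (0 : EuclideanSpace ℝ (Fin 3)) (1 / 3))),
      ‖uncurry v w‖ ≤ B := ae_restrict_of_ae_restrict_of_subset hcover hae
  rw [eLpNorm_exponent_top]
  exact eLpNormEssSup_lt_top_of_ae_bound hae'

/-- **Barker–Prange 2020, Theorem 2, proved** (the named fact `BarkerPrange2020_thm2`:
concentration of the `L³` norm at the similarity scale near a Type-I singularity of a Leray–Hopf
solution first blowing up at `T`), by the accepted reduction to Theorem 1 in slab form
(`BarkerPrange2020_thm2_of_thm1`: the printed proof §4.2 plus the restarting of the regular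
Leray–Hopf solution as a local energy solution) and `BarkerPrange2020_thm1_slab`.
[cite: BarkerPrange2020, Thm. 2 (arXiv:1812.09115 pp. 4–5) with its proof §4.2 (p. 16) and Thm. 1 (p. 2)] -/
theorem BarkerPrange2020_thm2_holds : BarkerPrange2020_thm2 :=
  BarkerPrange2020_thm2_of_thm1 BarkerPrange2020_thm1_slab

end Literature.Analysis.FluidPDE

end
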